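import Mathlib
import Summits.NavierStokesRegularity.NavierStokesRegularity.Theorems.EulerZoomLiouvillePowerGaugeEulerLiouvillePolynomialVorticityMember
import Summits.NavierStokesRegularity.NavierStokesRegularity.Theorems.EulerZoomLiouvillePowerGaugeEulerLiouvilleFrozenLambVectorMember
import HarnessLib

/-!
# Crux `EulerZoomLiouville.PowerGaugeEulerLiouville` (stmt-NavierStokesRegularity-19832), stub `stub_nonSelfSimilarRest`:
# VORTICITY / LAMB VECTOR POLYNOMIAL IN TIME, A.E. FORMS ⇒ TRIVIAL (any degree)

Helper file (theorems only; `--supports stmt-NavierStokesRegularity-19832`; def-free).  Hand leafhand-ns-eulerzoomliouville-10 g4; the pointwise (a.e.) companions of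
`…PolynomialVorticityMember` (the `𝒟'` forms), generalising `Loc.ae_eq_zero_of_aeAffineWeakVorticity` (`…AffineVorticityMember`, degree 1) and
`Loc.ae_eq_zero_of_aeFrozenLambPairingPast` (`…FrozenLambVectorMember`, degree 0) to any degree `N`.

* `PolyAe.integral_pow_mul_iterate_deriv_eq_zero` — `∫ t^k θ^{(N+1)}(t) dt = 0` for `k ≤ N`, `θ ∈ C_c^∞(ℝ)` (`N+1` integrations by parts,
  `DistPoly.setIntegral_iterate_deriv_mul_eq`, Mathlib `iter_deriv_pow`).
* `Loc.ae_eq_zero_of_aePolynomialWeakVorticity` — the antisymmetric part of `H(t,x)` equals that of `Σ_{k≤N} t^k W_k(x)` a.e. on `(−∞,T₁) × ℝ³`,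
  `W_k ∈ L¹_loc` time-independent («`ω = Σ t^k ω_k`») ⇒ trivial.
* `Loc.ae_eq_zero_of_aePolynomialLambPairingPast` — for a.e. `t < T₁` the Lamb vector of the slice pairs with every curl pair as a polynomial in `t`:
  `∫ (⟪H u, η⟫ − ⟪H η, u⟫)(t) = Σ_{k≤N} F_k(g,a,b) t^k` («`ω × u ≡ Σ t^k L_k(x)` mod gradients») ⇒ trivial.
* Binder language `Birth.nonSelfSimilar_of_aePolynomialWeakVorticity` / `Birth.nonSelfSimilar_of_aePolynomialLambPairingPast`.

WHAT THIS IS NOT: not a proof of the stub or of the crux; nothing about Navier–Stokes. [folklore; MajdaBertozziCUP2002 §2.4]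
-/

noncomputable section

-- flat `Theorems/<Route><Decl>…` files of one crux share the namespace of the crux (tree convention)
set_option linter.dupNamespace false

open MeasureTheory Set Filter Topology Metric Function TopologicalSpace
open scoped RealInnerProductSpace NNReal ENNReal ContDiff

namespace Summit.NavierStokesRegularity.NavierStokesRegularity.Theorems.PowerGaugeEulerLiouville

open Literature.Analysis Literature.Analysis.FunctionSpaces Literature.Analysis.FluidPDE

namespace PolyAe

/-- **`∫ t^k θ^{(N+1)}(t) dt = 0` for `k ≤ N`** and a smooth compactly supported `θ`. [folklore] -/
theorem integral_pow_mul_iterate_deriv_eq_zero {θ : ℝ → ℝ} (hθ : ContDiff ℝ ∞ θ) (hθc : HasCompactSupport θ) {k N : ℕ} (hk : k ≤ N) :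
    ∫ t, t ^ k * deriv^[N + 1] θ t = 0 := by
  -- a window containing the support of `θ` (hence of all its derivatives)
  obtain ⟨R₀, hR₀⟩ := (hθc.isCompact : IsCompact (tsupport θ)).isBounded.subset_closedBall (0 : ℝ)
  set R : ℝ := max R₀ 0 with hRdef
  have hR : tsupport θ ⊆ closedBall (0 : ℝ) R := hR₀.trans (closedBall_subset_closedBall (le_max_left _ _))
  have hR0 : 0 ≤ R := le_max_right _ _
  have hsub : tsupport θ ⊆ Ioo (-(R + 1)) (R + 1) := by
    intro t ht
    have h := hR ht
    rw [Metric.mem_closedBall, Real.dist_eq, sub_zero, abs_le] at h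
    exact ⟨by linarith [h.1], by linarith [h.2]⟩
  have hab : -(R + 1) < R + 1 := by linarith
  have hvan : ∀ t : ℝ, t ∉ Ioo (-(R + 1)) (R + 1) → t ^ k * deriv^[N + 1] θ t = 0 := by
    intro t ht
    have h : t ∉ tsupport (deriv^[N + 1] θ) := fun h => ht (hsub (DistPoly.tsupport_iterate_deriv_subset (N + 1) h))
    rw [image_eq_zero_of_notMem_tsupport h, mul_zero]
  rw [← setIntegral_eq_integral_of_forall_compl_eq_zero hvan]
  have e1 : (fun t => t ^ k * deriv^[N + 1] θ t) = fun t => deriv^[N + 1] θ t * t ^ k := funext fun t => mul_comm _ _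
  have key := DistPoly.setIntegral_iterate_deriv_mul_eq hab (N + 1) (φ := θ) (f := fun s : ℝ => s ^ k) hθ hsub (contDiff_id.pow k)
  beta_reduce at key
  rw [e1, key, iter_deriv_pow' k (N + 1)]
  have hprod : (∏ i ∈ Finset.range (N + 1), ((k : ℝ) - i)) = 0 :=
    Finset.prod_eq_zero (i := k) (Finset.mem_range.2 (by omega)) (by simp)
  simp [hprod]

end PolyAe

/-! ## Member level -/

section Member

variable {ρ : ℝ} {u : ℝ → EuclideanSpace ℝ (Fin 3) → EuclideanSpace ℝ (Fin 3)} {p : ℝ → EuclideanSpace ℝ (Fin 3) → ℝ}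
  {H : ℝ → EuclideanSpace ℝ (Fin 3) → EuclideanSpace ℝ (Fin 3) →L[ℝ] EuclideanSpace ℝ (Fin 3)} {c : ℝ≥0} {T₁ : ℝ}

/-- **VORTICITY POLYNOMIAL IN TIME, A.E. FORM ⇒ TRIVIAL.**  If the antisymmetric part of the weak gradient is, a.e. on `(−∞,T₁) × ℝ³`, a POLYNOMIAL in time with
locally integrable coefficients `W_0, …, W_N : ℝ³ → (ℝ³ →L ℝ³)` — `⟪H(t,x)a, c⟫ − ⟪H(t,x)c, a⟫ = Σ_{k≤N} t^k (⟪W_k(x)a, c⟫ − ⟪W_k(x)c, a⟫)` a.e., all `a, c` —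
then the member is trivial (Fubini; `∫ t^k θ^{(N+1)} = 0`; `Loc.ae_eq_zero_of_polynomialWeakGradientCurl`). [folklore] -/
theorem Loc.ae_eq_zero_of_aePolynomialWeakVorticity (hρ : 0 < ρ)
    (hsw : IsSuitableWeakSolutionOn (slab (EuclideanSpace ℝ (Fin 3)) (Iio 0) isOpen_Iio) 0 0 u p)
    (hH : HasWeakSpatialGradientOn (slab (EuclideanSpace ℝ (Fin 3)) (Iio 0) isOpen_Iio) u H)
    (hc : ∀ a : ℝ, 0 < a → ENNReal.ofReal (a ^ (2 * ρ)) * cknA a (0 : ℝ × EuclideanSpace ℝ (Fin 3)) u +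
        ENNReal.ofReal (a ^ ρ) * cknE a (0 : ℝ × EuclideanSpace ℝ (Fin 3)) H +
        ENNReal.ofReal (a ^ (2 * ρ)) * cknD a (0 : ℝ × EuclideanSpace ℝ (Fin 3)) p ≤ (c : ℝ≥0∞))
    (hT₁ : T₁ ≤ 0) (N : ℕ) {W : ℕ → EuclideanSpace ℝ (Fin 3) → EuclideanSpace ℝ (Fin 3) →L[ℝ] EuclideanSpace ℝ (Fin 3)}
    (hW : ∀ k, LocallyIntegrable (W k) volume)
    (hpoly : ∀ᵐ z ∂(volume.restrict (Iio T₁ ×ˢ (univ : Set (EuclideanSpace ℝ (Fin 3))))), ∀ a b : EuclideanSpace ℝ (Fin 3),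
      ⟪H z.1 z.2 a, b⟫ - ⟪H z.1 z.2 b, a⟫ = ∑ k ∈ Finset.range (N + 1), z.1 ^ k * (⟪W k z.2 a, b⟫ - ⟪W k z.2 b, a⟫)) :
    uncurry u =ᵐ[volume.restrict (Iio (0 : ℝ) ×ˢ (univ : Set (EuclideanSpace ℝ (Fin 3))))] 0 := by
  -- adapted from `Loc.ae_eq_zero_of_aeAffineWeakVorticity` (…AffineVorticityMember), sums in place of the two coefficients
  refine Loc.ae_eq_zero_of_polynomialWeakGradientCurl hρ hsw hH hc hT₁ N fun θ hθ hθc hθT g hg a c' => ?_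
  have e : (volume.restrict (Iio T₁ ×ˢ (univ : Set (EuclideanSpace ℝ (Fin 3)))) : Measure (ℝ × EuclideanSpace ℝ (Fin 3))) =
      ((volume : Measure ℝ).restrict (Iio T₁)).prod (volume : Measure (EuclideanSpace ℝ (Fin 3))) := by
    rw [Measure.volume_eq_prod, ← Measure.restrict_univ (μ := (volume : Measure (EuclideanSpace ℝ (Fin 3)))),
      Measure.prod_restrict, Measure.restrict_univ]
  rw [e] at hpoly
  have hsl := Measure.ae_ae_of_ae_prod hpoly
  have hint : ∀ k, Integrable (fun x => g x * (⟪W k x a, c'⟫ - ⟪W k x c', a⟫)) volume := by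
    intro k
    have hF : LocallyIntegrable (fun x => ⟪W k x a, c'⟫ - ⟪W k x c', a⟫) volume := by
      set Λ : (EuclideanSpace ℝ (Fin 3) →L[ℝ] EuclideanSpace ℝ (Fin 3)) →L[ℝ] ℝ :=
        (innerSL ℝ c').comp (ContinuousLinearMap.apply ℝ (EuclideanSpace ℝ (Fin 3)) a) -
          (innerSL ℝ a).comp (ContinuousLinearMap.apply ℝ (EuclideanSpace ℝ (Fin 3)) c') with hΛ
      have h2 : (fun x => ⟪W k x a, c'⟫ - ⟪W k x c', a⟫) = fun x => Λ (W k x) := by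
        funext x
        simp [hΛ, innerSL_apply_apply, real_inner_comm]
      have h3 := Λ.locallyIntegrableOn_comp (locallyIntegrableOn_univ.2 (hW k))
      rw [locallyIntegrableOn_univ] at h3
      rw [h2]
      simpa only [Function.comp_def] using h3
    exact hF.integrable_smul_left_of_hasCompactSupport hg.contDiff.continuous hg.hasCompactSupport
  set C : ℕ → ℝ := fun k => ∫ x, g x * (⟪W k x a, c'⟫ - ⟪W k x c', a⟫) with hC
  have hpt : ∀ᵐ t ∂(volume : Measure ℝ),
      ∫ x, deriv^[N + 1] θ t * g x * (⟪H t x a, c'⟫ - ⟪H t x c', a⟫) = ∑ k ∈ Finset.range (N + 1), (t ^ k * deriv^[N + 1] θ t) * C k := by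
    filter_upwards [ae_imp_of_ae_restrict hsl] with t ht
    by_cases htT : t < T₁
    · have h2 := ht htT
      have e1 : (fun x => deriv^[N + 1] θ t * g x * (⟪H t x a, c'⟫ - ⟪H t x c', a⟫)) =ᵐ[volume]
          fun x => ∑ k ∈ Finset.range (N + 1), (t ^ k * deriv^[N + 1] θ t) * (g x * (⟪W k x a, c'⟫ - ⟪W k x c', a⟫)) := by
        filter_upwards [h2] with x hx
        rw [mul_assoc, hx a c', Finset.mul_sum, Finset.mul_sum]
        refine Finset.sum_congr rfl fun k _ => ?_
        ring
      rw [integral_congr_ae e1, integral_finsetSum _ fun k _ => (hint k).const_mul _]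
      refine Finset.sum_congr rfl fun k _ => ?_
      rw [integral_const_mul]
    · have h0 : deriv^[N + 1] θ t = 0 :=
        image_eq_zero_of_notMem_tsupport fun h => (not_lt.2 (not_lt.1 htT)) ((DistPoly.tsupport_iterate_deriv_subset (N + 1)).trans hθT h)
      simp [h0]
  have hi : ∀ k, Integrable (fun t => t ^ k * deriv^[N + 1] θ t * C k) (volume : Measure ℝ) := by
    intro k
    have h1 : Continuous fun t => t ^ k * deriv^[N + 1] θ t := (continuous_id.pow k).mul (hθ.iterate_deriv (N + 1)).continuous
    have h2 : HasCompactSupport fun t => t ^ k * deriv^[N + 1] θ t := (DistPoly.hasCompactSupport_iterate_deriv hθc (N + 1)).mul_left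
    exact (h1.integrable_of_hasCompactSupport h2).mul_const _
  rw [integral_congr_ae hpt, integral_finsetSum _ fun k _ => hi k]
  refine Finset.sum_eq_zero fun k hk => ?_
  rw [integral_mul_const, PolyAe.integral_pow_mul_iterate_deriv_eq_zero hθ hθc (Nat.lt_succ_iff.1 (Finset.mem_range.1 hk)), zero_mul]

/-- **LAMB PAIRINGS POLYNOMIAL IN TIME ⇒ TRIVIAL** (member level, every `ρ > 0`, any degree `N`): crux hypotheses verbatim, `T₁ ≤ 0`, and time-independent tables
`F_0, …, F_N` with `∫ (⟪H u, η⟫ − ⟪H η, u⟫)(t) dx = Σ_{k≤N} F_k(g,a,b) t^k` for a.e. `t < T₁` and every curl pair `η = (∂ₐg)b − (∂_b g)a`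
(«`ω × u ≡ Σ_k t^k L_k(x)` modulo gradients») ⇒ `u = 0` a.e. (slice identity `LambSlice.…`, Fubini, `∫ t^k θ^{(N+1)} = 0`, `Loc.ae_eq_zero_of_polynomialLambCurlPast`).
[folklore; MajdaBertozziCUP2002 §2.4] -/
theorem Loc.ae_eq_zero_of_aePolynomialLambPairingPast (hρ : 0 < ρ)
    (hsw : IsSuitableWeakSolutionOn (slab (EuclideanSpace ℝ (Fin 3)) (Iio 0) isOpen_Iio) 0 0 u p)
    (hH : HasWeakSpatialGradientOn (slab (EuclideanSpace ℝ (Fin 3)) (Iio 0) isOpen_Iio) u H)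
    (hgauge : ∀ a : ℝ, 0 < a →
      ENNReal.ofReal (a ^ (2 * ρ)) * cknA a (0 : ℝ × EuclideanSpace ℝ (Fin 3)) u +
          ENNReal.ofReal (a ^ ρ) * cknE a (0 : ℝ × EuclideanSpace ℝ (Fin 3)) H +
        ENNReal.ofReal (a ^ (2 * ρ)) * cknD a (0 : ℝ × EuclideanSpace ℝ (Fin 3)) p ≤ (c : ℝ≥0∞))
    (hT₁ : T₁ ≤ 0) (N : ℕ) (F : ℕ → (EuclideanSpace ℝ (Fin 3) → ℝ) → EuclideanSpace ℝ (Fin 3) → EuclideanSpace ℝ (Fin 3) → ℝ)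
    (hLamb : ∀ᵐ t ∂(volume.restrict (Iio T₁)),
      ∀ g : EuclideanSpace ℝ (Fin 3) → ℝ, IsTestFunctionOn (⊤ : Opens (EuclideanSpace ℝ (Fin 3))) g → ∀ a b : EuclideanSpace ℝ (Fin 3),
        ∫ x, (⟪H t x (u t x), fderiv ℝ g x a • b - fderiv ℝ g x b • a⟫ - ⟪H t x (fderiv ℝ g x a • b - fderiv ℝ g x b • a), u t x⟫) =
          ∑ k ∈ Finset.range (N + 1), F k g a b * t ^ k) :
    uncurry u =ᵐ[volume.restrict (Iio (0 : ℝ) ×ˢ (univ : Set (EuclideanSpace ℝ (Fin 3))))] 0 := by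
  -- adapted from `Loc.ae_eq_zero_of_aeFrozenLambPairingPast` (…FrozenLambVectorMember), sums in place of the constant table
  have hdist := hsw.distributional
  have hprod : ∀ S : Set ℝ, (volume.restrict (S ×ˢ (univ : Set (EuclideanSpace ℝ (Fin 3)))) : Measure (ℝ × EuclideanSpace ℝ (Fin 3))) =
      ((volume : Measure ℝ).restrict S).prod (volume : Measure (EuclideanSpace ℝ (Fin 3))) := by
    intro S
    rw [Measure.volume_eq_prod, ← Measure.restrict_univ (μ := (volume : Measure (EuclideanSpace ℝ (Fin 3)))),
      Measure.prod_restrict, Measure.restrict_univ]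
  have h1 : ∀ᵐ t ∂(volume.restrict (Iio T₁)),
      HasWeakFDerivOn (⊤ : Opens (EuclideanSpace ℝ (Fin 3))) volume (u t) (H t) := FrameSteady.ae_hasWeakFDerivOn_slice_past hH hT₁
  have h2 : ∀ᵐ t ∂(volume.restrict (Iio T₁)), LocallyIntegrable (fun x => ‖u t x‖ ^ 2) volume := by
    have hu2 : LocallyIntegrableOn (fun z => ‖uncurry u z‖ ^ 2)
        ((slab (EuclideanSpace ℝ (Fin 3)) (Iio 0) isOpen_Iio : Opens (ℝ × EuclideanSpace ℝ (Fin 3))) : Set (ℝ × EuclideanSpace ℝ (Fin 3))) volume :=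
      hdist.2.1
    have h := ae_slice_locallyIntegrable (g := fun z : ℝ × EuclideanSpace ℝ (Fin 3) => ‖uncurry u z‖ ^ 2)
      (fun K hK hKQ => hu2.integrableOn_compact_subset hKQ hK)
    rw [ae_restrict_iff' measurableSet_Iio]
    filter_upwards [h] with t ht htT
    exact ht (lt_of_lt_of_le htT hT₁)
  have h3 : ∀ᵐ t ∂(volume.restrict (Iio T₁)), LocallyIntegrable (fun x => ‖H t x‖ ^ 2) volume := by
    obtain ⟨G, hG, hG2, -⟩ := hsw.localEnergy
    have hae := hH.ae_eq hG
    have hHm : AEStronglyMeasurable (uncurry H)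
        (volume.restrict ((slab (EuclideanSpace ℝ (Fin 3)) (Iio 0) isOpen_Iio : Opens (ℝ × EuclideanSpace ℝ (Fin 3))) :
          Set (ℝ × EuclideanSpace ℝ (Fin 3)))) := hH.locallyIntegrableOn_grad.aestronglyMeasurable
    have hK : ∀ K : Set (ℝ × EuclideanSpace ℝ (Fin 3)), IsCompact K →
        K ⊆ ((slab (EuclideanSpace ℝ (Fin 3)) (Iio 0) isOpen_Iio : Opens (ℝ × EuclideanSpace ℝ (Fin 3))) : Set (ℝ × EuclideanSpace ℝ (Fin 3))) →
        IntegrableOn (fun z : ℝ × EuclideanSpace ℝ (Fin 3) => ‖uncurry H z‖ ^ 2) K volume := by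
      intro K hKc hKQ
      have hm : AEStronglyMeasurable (fun z : ℝ × EuclideanSpace ℝ (Fin 3) => ‖uncurry H z‖ ^ 2) (volume.restrict K) :=
        ((hHm.mono_set hKQ).norm.pow 2)
      refine ⟨hm, ?_⟩
      have hfin := hG2 K hKQ hKc
      have haeK : ∀ᵐ z ∂(volume.restrict K), uncurry H z = uncurry G z := ae_restrict_of_ae_restrict_of_subset hKQ hae
      refine lt_of_le_of_lt ?_ hfin
      refine lintegral_mono_ae ?_
      filter_upwards [haeK] with z hz
      rw [← ofReal_norm, norm_pow, norm_norm]
      refine ENNReal.ofReal_le_ofReal ?_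
      have := norm_sq_le_frobeniusNormSq (G z.1 z.2)
      have e : uncurry H z = G z.1 z.2 := hz
      rw [e]
      exact this
    have h := ae_slice_locallyIntegrable (g := fun z : ℝ × EuclideanSpace ℝ (Fin 3) => ‖uncurry H z‖ ^ 2) hK
    rw [ae_restrict_iff' measurableSet_Iio]
    filter_upwards [h] with t ht htT
    exact ht (lt_of_lt_of_le htT hT₁)
  have h4 : ∀ᵐ t ∂(volume.restrict (Iio T₁)), ∀ᵐ x ∂(volume : Measure (EuclideanSpace ℝ (Fin 3))),
      ∑ j, ⟪(EuclideanSpace.basisFun (Fin 3) ℝ) j, H t x ((EuclideanSpace.basisFun (Fin 3) ℝ) j)⟫ = 0 := by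
    have htr := SerrinBoundedHolder.ae_trace_eq_zero hdist hH
    have h' : ∀ᵐ z ∂(volume.restrict (Iio T₁ ×ˢ (univ : Set (EuclideanSpace ℝ (Fin 3))))),
        ∑ j, H z.1 z.2 (EuclideanSpace.single j (1 : ℝ)) j = 0 := by
      rw [ae_restrict_iff' (measurableSet_Iio.prod MeasurableSet.univ)]
      filter_upwards [htr] with z hz hmem
      exact hz (by
        have : z.1 < 0 := lt_of_lt_of_le (mem_prod.1 hmem).1 hT₁
        simpa [slab] using this)
    rw [hprod] at h'
    filter_upwards [Measure.ae_ae_of_ae_prod h'] with t ht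
    filter_upwards [ht] with x hx
    rw [← hx]
    refine Finset.sum_congr rfl fun j _ => ?_
    rw [EuclideanSpace.basisFun_apply, EuclideanSpace.inner_single_left]
    simp
  -- the velocity-tested advection of a.e. slice is the polynomial `−Σ F_k t^k`
  have hslice : ∀ᵐ t ∂(volume.restrict (Iio T₁)),
      ∀ g : EuclideanSpace ℝ (Fin 3) → ℝ, IsTestFunctionOn (⊤ : Opens (EuclideanSpace ℝ (Fin 3))) g → ∀ a b : EuclideanSpace ℝ (Fin 3),
        ∫ x, ⟪u t x, fderiv ℝ (fun x => fderiv ℝ g x a • b - fderiv ℝ g x b • a) x (u t x)⟫ = -∑ k ∈ Finset.range (N + 1), F k g a b * t ^ k := by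
    filter_upwards [h1, h2, h3, h4, hLamb] with t ht1 ht2 ht3 ht4 ht5
    intro g hg a b
    rw [LambSlice.integral_inner_fderiv_apply_self_eq_neg_lambPairing ht1 ht2 ht3 ht4 hg a b, ht5 g hg a b]
  refine Loc.ae_eq_zero_of_polynomialLambCurlPast hρ hsw hH hgauge hT₁ N fun θ hθ hθc hθT g hg a b => ?_
  set η : EuclideanSpace ℝ (Fin 3) → EuclideanSpace ℝ (Fin 3) := fun x => fderiv ℝ g x a • b - fderiv ℝ g x b • a with hηdef
  have hη := isTestFunctionOn_curlPair hg a b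
  have hθT0 : tsupport θ ⊆ Iio 0 := hθT.trans (Iio_subset_Iio hT₁)
  have hκ : ContDiff ℝ ∞ (deriv^[N + 1] θ) := hθ.iterate_deriv (N + 1)
  have hκc : HasCompactSupport (deriv^[N + 1] θ) := DistPoly.hasCompactSupport_iterate_deriv hθc (N + 1)
  have hκT : tsupport (deriv^[N + 1] θ) ⊆ Iio 0 := (DistPoly.tsupport_iterate_deriv_subset (N + 1)).trans hθT0
  have hu : LocallyIntegrableOn (uncurry u) (Iio 0 ×ˢ (univ : Set (EuclideanSpace ℝ (Fin 3)))) volume := by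
    simpa only [coe_slab] using hdist.1
  have hum : AEStronglyMeasurable (uncurry u) (volume.restrict (Iio (0 : ℝ) ×ˢ (univ : Set (EuclideanSpace ℝ (Fin 3))))) :=
    hu.aestronglyMeasurable
  have hu2 : LocallyIntegrableOn (fun z => ‖uncurry u z‖ ^ 2) (Iio (0 : ℝ) ×ˢ (univ : Set (EuclideanSpace ℝ (Fin 3)))) volume := by
    simpa only [coe_slab] using hdist.2.1
  have iB := AntiMember.integrable_mul_inner_fderiv_apply hum hu2 hκ.continuous hκc hκT (hη.contDiff.of_le (by norm_cast)) hη.hasCompactSupport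
  rw [Measure.volume_eq_prod] at iB
  rw [Measure.volume_eq_prod, integral_prod _ iB]
  have hpt : ∀ᵐ t ∂(volume : Measure ℝ),
      ∫ x, deriv^[N + 1] θ t * ⟪u t x, fderiv ℝ η x (u t x)⟫ = ∑ k ∈ Finset.range (N + 1), (t ^ k * deriv^[N + 1] θ t) * (-F k g a b) := by
    filter_upwards [ae_imp_of_ae_restrict hslice] with t ht
    by_cases htT : t < T₁
    · rw [integral_const_mul, ht htT g hg a b, mul_neg, Finset.mul_sum, ← Finset.sum_neg_distrib]
      refine Finset.sum_congr rfl fun k _ => ?_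
      ring
    · have h0 : deriv^[N + 1] θ t = 0 :=
        image_eq_zero_of_notMem_tsupport fun h => (not_lt.2 (not_lt.1 htT)) ((DistPoly.tsupport_iterate_deriv_subset (N + 1)).trans hθT h)
      simp [h0]
  have hi : ∀ k, Integrable (fun t => t ^ k * deriv^[N + 1] θ t * (-F k g a b)) (volume : Measure ℝ) := by
    intro k
    have h1 : Continuous fun t => t ^ k * deriv^[N + 1] θ t := (continuous_id.pow k).mul hκ.continuous
    have h2 : HasCompactSupport fun t => t ^ k * deriv^[N + 1] θ t := hκc.mul_left
    exact (h1.integrable_of_hasCompactSupport h2).mul_const _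
  show ∫ t, ∫ x, deriv^[N + 1] θ t * ⟪u t x, fderiv ℝ η x (u t x)⟫ = 0
  rw [integral_congr_ae hpt, integral_finsetSum _ fun k _ => hi k]
  refine Finset.sum_eq_zero fun k hk => ?_
  rw [integral_mul_const, PolyAe.integral_pow_mul_iterate_deriv_eq_zero hθ hθc (Nat.lt_succ_iff.1 (Finset.mem_range.1 hk)), zero_mul]

end Member

/-! ## Binder language -/

/-- **Binder language: NO MEMBER HAS VORTICITY POLYNOMIAL IN TIME (A.E. FORM) IN ITS FAR PAST**: for some `T₁ ≤ 0`, some `N` and locally integrable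
time-independent `W_0, …, W_N`, the antisymmetric part of `H(t,x)` equals that of `Σ_{k≤N} t^k W_k(x)` for a.e. `(t,x) ∈ (−∞,T₁) × ℝ³` ⇒ trivial. [folklore] -/
theorem Birth.nonSelfSimilar_of_aePolynomialWeakVorticity :
    ∀ ρ : ℝ, 0 < ρ →
      ∀ (u : ℝ → EuclideanSpace ℝ (Fin 3) → EuclideanSpace ℝ (Fin 3)) (p : ℝ → EuclideanSpace ℝ (Fin 3) → ℝ)
        (H : ℝ → EuclideanSpace ℝ (Fin 3) → EuclideanSpace ℝ (Fin 3) →L[ℝ] EuclideanSpace ℝ (Fin 3)) (c : ℝ≥0),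
        Birth.InClass ρ u p H c →
          (∃ T₁ : ℝ, T₁ ≤ 0 ∧ ∃ N : ℕ, ∃ W : ℕ → EuclideanSpace ℝ (Fin 3) → EuclideanSpace ℝ (Fin 3) →L[ℝ] EuclideanSpace ℝ (Fin 3),
              (∀ k, LocallyIntegrable (W k) volume) ∧
              ∀ᵐ z ∂(volume.restrict (Iio T₁ ×ˢ (univ : Set (EuclideanSpace ℝ (Fin 3))))), ∀ a b : EuclideanSpace ℝ (Fin 3),
                ⟪H z.1 z.2 a, b⟫ - ⟪H z.1 z.2 b, a⟫ = ∑ k ∈ Finset.range (N + 1), z.1 ^ k * (⟪W k z.2 a, b⟫ - ⟪W k z.2 b, a⟫)) →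
          uncurry u =ᵐ[volume.restrict (Iio (0 : ℝ) ×ˢ (univ : Set (EuclideanSpace ℝ (Fin 3))))] 0 := by
  intro ρ hρ u p H c hcl h
  obtain ⟨T₁, hT₁, N, W, hW, hp⟩ := h
  exact Loc.ae_eq_zero_of_aePolynomialWeakVorticity hρ hcl.1 hcl.2.1 hcl.2.2 hT₁ N hW hp

/-- **Binder language: NO MEMBER HAS LAMB PAIRINGS POLYNOMIAL IN TIME IN ITS FAR PAST**: for some `T₁ ≤ 0`, `N`, tables `F_0, …, F_N`, for a.e. `t < T₁` the Lamb
vector of the slice pairs with every curl pair as `Σ_{k≤N} F_k(g,a,b) t^k` ⇒ trivial (`N = 0`: `Birth.nonSelfSimilar_of_aeFrozenLambPairingPast`). [folklore] -/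
theorem Birth.nonSelfSimilar_of_aePolynomialLambPairingPast :
    ∀ ρ : ℝ, 0 < ρ →
      ∀ (u : ℝ → EuclideanSpace ℝ (Fin 3) → EuclideanSpace ℝ (Fin 3)) (p : ℝ → EuclideanSpace ℝ (Fin 3) → ℝ)
        (H : ℝ → EuclideanSpace ℝ (Fin 3) → EuclideanSpace ℝ (Fin 3) →L[ℝ] EuclideanSpace ℝ (Fin 3)) (c : ℝ≥0),
        Birth.InClass ρ u p H c →
          (∃ T₁ : ℝ, T₁ ≤ 0 ∧ ∃ N : ℕ, ∃ F : ℕ → (EuclideanSpace ℝ (Fin 3) → ℝ) → EuclideanSpace ℝ (Fin 3) → EuclideanSpace ℝ (Fin 3) → ℝ,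
            ∀ᵐ t ∂(volume.restrict (Iio T₁)),
              ∀ g : EuclideanSpace ℝ (Fin 3) → ℝ, IsTestFunctionOn (⊤ : Opens (EuclideanSpace ℝ (Fin 3))) g → ∀ a b : EuclideanSpace ℝ (Fin 3),
                ∫ x, (⟪H t x (u t x), fderiv ℝ g x a • b - fderiv ℝ g x b • a⟫ -
                  ⟪H t x (fderiv ℝ g x a • b - fderiv ℝ g x b • a), u t x⟫) = ∑ k ∈ Finset.range (N + 1), F k g a b * t ^ k) →
          uncurry u =ᵐ[volume.restrict (Iio (0 : ℝ) ×ˢ (univ : Set (EuclideanSpace ℝ (Fin 3))))] 0 := by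
  intro ρ hρ u p H c hcl h
  obtain ⟨T₁, hT₁, N, F, hF⟩ := h
  exact Loc.ae_eq_zero_of_aePolynomialLambPairingPast hρ hcl.1 hcl.2.1 hcl.2.2 hT₁ N F hF

end Summit.NavierStokesRegularity.NavierStokesRegularity.Theorems.PowerGaugeEulerLiouville

end
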